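import Summits.PneNP.PneNP.Theorems.ConvexRankGatesConvexGateBlindXorDefs
import Literature.GroupTheory.PermutationGroups.SmallIndexSubgroups

/-!
# `ExactLifting` holds against gadget-symmetric LP factorisations (equivariant milestone)

Support file for crux `ConvexGateBlind` (stmt-PneNP-10680), line `xor-door-perfect-completeness`, open stub
`stub_exactLifting`; registered sub-goal `exactLifting_equivariant_lp`.  The shifted Index-lift
`viol_F(x[w]) - ε` (`x : Fin m → Fin t → 𝔽₂`, `w : Fin m → Fin t`) is invariant under the gadget group
`G = (S_t)^m` permuting the positions inside each block (`(σ • x) i p = x i ((σ i)⁻¹ p)`,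
`(σ • w) i = σ i (w i)`).  We prove the Yannakakis-type fact that every NON-NEGATIVE factorisation
`viol_F(x[w]) - ε = ∑_l U x l * V l w` which is `G`-symmetric (every `σ` is compensated by a relabelling
`τ` of the terms) has at least `C(t, d)` terms once `F` carries a degree-`d` perfect-completeness
pseudo-expectation and `t ≥ T(m, d)`: a counterexample to `ExactLifting` must break the gadget symmetry.

Proof. (1) For a term `l`, `{σ | ∀ x, U (σ • x) l = U x l}` is a subgroup of index `≤ #L` (the fibres
of `σ ↦ τ_σ l` lie in left cosets, `exists_stabilizer_index_le`); restricted to one block `i` it is a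
subgroup of `S_t` of index `< C(t, d)`, so the tree's Dixon–Mortimer theorem
`alternating_fixing_le_of_index_lt_choose` gives `X_{l,i}` with `#X_{l,i} < d` such that `U · l` is
invariant under the even permutations of block `i` fixing `X_{l,i}` (`exists_blockSupport`).
(2) A union bound (`exists_pointer`) gives a pointer `p` such that every `B_l := {i | p i ∈ X_{l,i} ∨
next (p i) ∈ X_{l,i}}` has `≤ d` blocks (`next = finRotate t`).  (3) Encode `y : Fin m → 𝔽₂` by the
table `x^y` with `y i` at `p i`, `y i + 1` at `next (p i)`, `0` elsewhere (`x^y[p] = y`); flipping `y i`,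
`i ∉ B_l`, is the even permutation `swap (p i) (next (p i)) * swap q₀ q₁` of block `i` fixing `X_{l,i}`
(`flip_invariant`), so `y ↦ U (x^y) l * V l p` is a non-negative `d`-junta (`junta_of_flip`).  (4) The
identity at `(x^y, p)` and the pseudo-expectation give `-ε = Ẽ[viol_F - ε] = ∑_l Ẽ[h_l] ≥ 0`.
-/

set_option linter.dupNamespace false -- `Summit.PneNP.PneNP.…`: summit = sub-problem (D-0017)

namespace Summit.PneNP.PneNP.Theorems.XorDoor

open scoped BigOperators
open Finset

/-! ## §1 Stabiliser subgroups of a symmetric family of functions -/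

/-- A subgroup `H` has index at most `#L` as soon as some map `f : G → L` has all its fibres inside
left cosets of `H`. -/
theorem index_le_card_of_fibre {G : Type*} [Group G] (H : Subgroup G) {L : Type*} [Fintype L]
    (f : G → L) (hf : ∀ a b, f a = f b → a⁻¹ * b ∈ H) : H.index ≤ Fintype.card L := by
  have hg : Function.Injective fun q : G ⧸ H => f q.out := fun q q' hqq' => by
    have h1 := hf _ _ hqq'
    rwa [← QuotientGroup.eq, QuotientGroup.out_eq', QuotientGroup.out_eq'] at h1
  exact (Nat.card_le_card_of_injective _ hg).trans_eq Nat.card_eq_fintype_card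

/-- **Stabiliser of a term of a symmetric family.** `ax` is a (left) action of `G` on `A` given by its
two laws, `U : A → L → ℝ` a finite family of functions on `A` such that every `g` is compensated by a
relabelling `τ g` of the terms (`U (g • a) (τ g l) = U a l`).  Then the stabiliser
`{g | U (g • ·) l = U · l}` of the term `l` is a subgroup of index `≤ #L`. -/
theorem exists_stabilizer_index_le {G A L : Type*} [Group G] [Fintype L] (ax : G → A → A)
    (h1 : ∀ a, ax 1 a = a) (hmul : ∀ g g' a, ax (g * g') a = ax g (ax g' a))
    (U : A → L → ℝ) (τ : G → L → L) (hτ : ∀ g l a, U (ax g a) (τ g l) = U a l) (l : L) :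
    ∃ H : Subgroup G, (∀ g, g ∈ H ↔ ∀ a, U (ax g a) l = U a l) ∧ H.index ≤ Fintype.card L := by
  have hinv : ∀ g a, ax g (ax g⁻¹ a) = a := fun g a => by rw [← hmul, mul_inv_cancel, h1]
  refine ⟨{ carrier := {g | ∀ a, U (ax g a) l = U a l}
            mul_mem' := ?_, one_mem' := ?_, inv_mem' := ?_ }, fun g => Iff.rfl, ?_⟩
  · intro g g' hg hg' a
    rw [hmul]
    exact ((hg : ∀ a, U (ax g a) l = U a l) _).trans ((hg' : ∀ a, U (ax g' a) l = U a l) a)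
  · intro a
    rw [h1]
  · intro g hg a
    rw [← (hg : ∀ a, U (ax g a) l = U a l) (ax g⁻¹ a), hinv]
  · refine index_le_card_of_fibre _ (fun g => τ g l) fun g g' hgg' a => ?_
    have e1 := hτ g l (ax (g⁻¹ * g') a)
    have hgg' : τ g l = τ g' l := hgg'
    rw [← hmul, mul_inv_cancel_left, hgg', hτ g' l a] at e1
    exact e1.symm

/-! ## §2 Per-block small supports (Dixon–Mortimer) -/

/-- **Per-block small support.** If the family `U · l` is symmetric under the block permutations
`x ↦ (i, p) ↦ x i ((σ i)⁻¹ p)` up to relabelling, `t > 8`, `1 ≤ d ≤ t/4` and `#L < C(t, d)`, then for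
every term `l` and block `i` there is a set `X` of fewer than `d` positions such that `U · l` is
invariant under every even permutation of block `i` fixing `X` pointwise. -/
theorem exists_blockSupport {m t d : ℕ} {L : Type*} [Fintype L]
    (U : (Fin m → Fin t → ZMod 2) → L → ℝ) (τ : (Fin m → Equiv.Perm (Fin t)) → L → L)
    (hτ : ∀ σ l x, U (fun i p => x i ((σ i).symm p)) (τ σ l) = U x l)
    (ht8 : 8 < t) (hd : 1 ≤ d) (h4d : 4 * d ≤ t) (hL : Fintype.card L < t.choose d)
    (l : L) (i : Fin m) :
    ∃ X : Finset (Fin t), X.card < d ∧ ∀ ρ : Equiv.Perm (Fin t), (∀ a ∈ X, ρ a = a) →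
      Equiv.Perm.sign ρ = 1 →
      ∀ x, U (fun j q => x j (((Pi.mulSingle i ρ : Fin m → Equiv.Perm (Fin t)) j).symm q)) l
        = U x l := by
  classical
  obtain ⟨H, hH, hidx⟩ := exists_stabilizer_index_le (G := Equiv.Perm (Fin t))
    (fun π (x : Fin m → Fin t → ZMod 2) => fun j q =>
      x j (((Pi.mulSingle i π : Fin m → Equiv.Perm (Fin t)) j).symm q))
    (fun a => by funext j q; simp only [Pi.mulSingle_one]; rfl)
    (fun g g' a => by funext j q; simp only [Pi.mulSingle_mul]; rfl)
    U (fun π => τ (Pi.mulSingle i π)) (fun π l x => hτ _ l x) l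
  have hidx' : H.index < (Fintype.card (Fin t)).choose d := by
    rw [Fintype.card_fin]; exact lt_of_le_of_lt hidx hL
  obtain ⟨X, hXcard, hX⟩ :=
    Literature.GroupTheory.PermutationGroups.alternating_fixing_le_of_index_lt_choose H d
      (by rw [Fintype.card_fin]; exact ht8) hd (by rw [Fintype.card_fin]; exact h4d) hidx'
  exact ⟨X, hXcard, fun ρ hfix hsign => (hH ρ).1 (hX ρ hfix hsign)⟩

/-! ## §3 Choice of the pointer (counting) -/

/-- **A pointer meeting few supports.** Given sets `X l i` of fewer than `d` positions and any
permutation `nx` of the positions, if `#L · C(m, d+1) · (2d)^{d+1} < t^{d+1}` then some pointer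
`p : Fin m → Fin t` has, for every `l`, at most `d` blocks `i` with `p i ∈ X l i` or `nx (p i) ∈ X l i`
(union bound over `l` and over the `(d+1)`-sets of bad blocks). -/
theorem exists_pointer {m t d : ℕ} {L : Type*} [Fintype L] (X : L → Fin m → Finset (Fin t))
    (hX : ∀ l i, (X l i).card < d) (nx : Equiv.Perm (Fin t)) (ht : 1 ≤ t)
    (hLt : Fintype.card L * (m.choose (d + 1) * (2 * d) ^ (d + 1)) < t ^ (d + 1)) :
    ∃ p : Fin m → Fin t, ∀ l, (univ.filter fun i => p i ∈ X l i ∨ nx (p i) ∈ X l i).card ≤ d := by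
  classical
  -- the per-block hit sets and their size
  set Hit : L → Fin m → Finset (Fin t) := fun l i => univ.filter fun a => a ∈ X l i ∨ nx a ∈ X l i
    with hHit
  have hHit_card : ∀ l i, (Hit l i).card ≤ 2 * d := by
    intro l i
    calc (Hit l i).card ≤ (X l i ∪ (X l i).map nx.symm.toEmbedding).card := by
          refine card_le_card fun a ha => ?_
          rw [hHit, mem_filter] at ha
          rcases ha.2 with h | h
          · exact mem_union_left _ h
          · exact mem_union_right _ (mem_map.2 ⟨nx a, h, by simp⟩)
      _ ≤ (X l i).card + ((X l i).map nx.symm.toEmbedding).card := card_union_le _ _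
      _ = 2 * (X l i).card := by rw [card_map]; ring
      _ ≤ 2 * d := by have := hX l i; omega
  by_contra hbad
  push Not at hbad
  -- every pointer is bad, hence lies in one of the boxes `Bad (l, I)`
  set Bad : L × Finset (Fin m) → Finset (Fin m → Fin t) := fun lI =>
    Fintype.piFinset fun i => if i ∈ lI.2 then Hit lI.1 i else univ with hBad
  set Idx : Finset (L × Finset (Fin m)) := univ ×ˢ powersetCard (d + 1) univ with hIdx
  have hcover : (univ : Finset (Fin m → Fin t)) ⊆ Idx.biUnion Bad := by
    intro p _
    obtain ⟨l, hl⟩ := hbad p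
    obtain ⟨I, hIB, hIcard⟩ := exists_subset_card_eq (Nat.succ_le_of_lt hl)
    rw [mem_biUnion]
    refine ⟨(l, I), ?_, ?_⟩
    · rw [hIdx, mem_product, mem_powersetCard]
      exact ⟨mem_univ _, subset_univ _, hIcard⟩
    · rw [hBad, Fintype.mem_piFinset]
      intro i
      split_ifs with hi
      · have := hIB hi
        rw [mem_filter] at this
        rw [hHit, mem_filter]
        exact ⟨mem_univ _, this.2⟩
      · exact mem_univ _
  -- `d + 1 ≤ m`
  have hm : d + 1 ≤ m := by
    obtain ⟨l, hl⟩ := hbad fun _ => ⟨0, ht⟩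
    exact hl.trans_le ((card_filter_le _ _).trans_eq (by simp))
  -- size of one box
  have hBad_card : ∀ lI ∈ Idx, (Bad lI).card ≤ (2 * d) ^ (d + 1) * t ^ (m - (d + 1)) := by
    rintro ⟨l, I⟩ hlI
    have hI : I.card = d + 1 := by rw [hIdx, mem_product, mem_powersetCard] at hlI; exact hlI.2.2
    rw [hBad, Fintype.card_piFinset, ← prod_mul_prod_compl I]
    refine Nat.mul_le_mul ?_ (le_of_eq ?_)
    · calc ∏ j ∈ I, (if j ∈ I then Hit l j else univ).card ≤ (2 * d) ^ I.card :=
            prod_le_pow_card _ _ _ fun j hj => by rw [if_pos hj]; exact hHit_card l j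
        _ = (2 * d) ^ (d + 1) := by rw [hI]
    · calc ∏ j ∈ Iᶜ, (if j ∈ I then Hit l j else univ).card = ∏ _j ∈ Iᶜ, t :=
            prod_congr rfl fun j hj => by
              rw [if_neg (mem_compl.1 hj), card_univ, Fintype.card_fin]
        _ = t ^ (m - (d + 1)) := by rw [prod_const, card_compl, Fintype.card_fin, hI]
  -- the union bound
  have htot : t ^ (d + 1) * t ^ (m - (d + 1)) ≤
      Fintype.card L * (m.choose (d + 1) * (2 * d) ^ (d + 1)) * t ^ (m - (d + 1)) := by
    calc t ^ (d + 1) * t ^ (m - (d + 1)) = t ^ m := by rw [← pow_add, Nat.add_sub_cancel' hm]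
      _ = (univ : Finset (Fin m → Fin t)).card := by
            rw [card_univ, Fintype.card_fun, Fintype.card_fin, Fintype.card_fin]
      _ ≤ (Idx.biUnion Bad).card := card_le_card hcover
      _ ≤ ∑ lI ∈ Idx, (Bad lI).card := card_biUnion_le
      _ ≤ ∑ _lI ∈ Idx, (2 * d) ^ (d + 1) * t ^ (m - (d + 1)) := sum_le_sum hBad_card
      _ = Fintype.card L * (m.choose (d + 1) * (2 * d) ^ (d + 1)) * t ^ (m - (d + 1)) := by
            rw [sum_const, smul_eq_mul, hIdx, card_product, card_univ, card_powersetCard, card_univ,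
              Fintype.card_fin]
            ring
  have hpos : 0 < t ^ (m - (d + 1)) := pow_pos ht _
  have := Nat.le_of_mul_le_mul_right htot hpos
  omega

/-! ## §4 The junta restriction -/

/-- **Flipping one unprotected bit is a block symmetry.** With the tables
`xOf y i q = y i` if `q = p i`, `= y i + 1` if `q = nx (p i)`, `= 0` otherwise: if `U · l` is invariant
under the even permutations of block `i` fixing `X` pointwise and `p i, nx (p i) ∉ X` (`#X + 4 ≤ t`),
then flipping `y i` does not change `U (xOf y) l` — the flip is the action of
`swap (p i) (nx (p i)) * swap q₀ q₁` for two filler positions `q₀ ≠ q₁` outside `X`. -/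
theorem flip_invariant {m t : ℕ} {L : Type*} (U : (Fin m → Fin t → ZMod 2) → L → ℝ) (l : L)
    (i : Fin m) (X : Finset (Fin t))
    (hX : ∀ ρ : Equiv.Perm (Fin t), (∀ a ∈ X, ρ a = a) → Equiv.Perm.sign ρ = 1 →
      ∀ x, U (fun j q => x j (((Pi.mulSingle i ρ : Fin m → Equiv.Perm (Fin t)) j).symm q)) l
        = U x l)
    (p : Fin m → Fin t) (nx : Equiv.Perm (Fin t)) (hnx : ∀ a, nx a ≠ a)
    (hpX : p i ∉ X) (hnX : nx (p i) ∉ X) (ht : X.card + 4 ≤ t)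
    (xOf : (Fin m → ZMod 2) → Fin m → Fin t → ZMod 2)
    (hxOf : ∀ y j q, xOf y j q = if q = p j then y j else if q = nx (p j) then y j + 1 else 0)
    (y : Fin m → ZMod 2) :
    U (xOf (Function.update y i (y i + 1))) l = U (xOf y) l := by
  classical
  have h2 : ∀ c : ZMod 2, c + 1 + 1 = c := by decide
  -- two filler positions outside `X ∪ {p i, nx (p i)}`
  obtain ⟨q0, q1, hq01, hq0X, hq1X, hq0a, hq0b, hq1a, hq1b⟩ :
      ∃ q0 q1 : Fin t, q0 ≠ q1 ∧ q0 ∉ X ∧ q1 ∉ X ∧ q0 ≠ p i ∧ q0 ≠ nx (p i) ∧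
        q1 ≠ p i ∧ q1 ≠ nx (p i) := by
    have hc : 1 < (univ \ (X ∪ {p i, nx (p i)})).card := by
      rw [card_sdiff_of_subset (subset_univ _), card_univ, Fintype.card_fin]
      have : (X ∪ {p i, nx (p i)}).card ≤ X.card + 2 := by
        calc (X ∪ {p i, nx (p i)}).card ≤ X.card + ({p i, nx (p i)} : Finset (Fin t)).card :=
              card_union_le _ _
          _ ≤ X.card + 2 := by gcongr; exact card_le_two
      omega
    obtain ⟨q0, hq0, q1, hq1, hne⟩ := one_lt_card.1 hc
    simp only [mem_sdiff, mem_univ, true_and, mem_union, mem_insert, mem_singleton, not_or]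
      at hq0 hq1
    exact ⟨q0, q1, hne, hq0.1, hq1.1, hq0.2.1, hq0.2.2, hq1.2.1, hq1.2.2⟩
  have hab : p i ≠ nx (p i) := (hnx (p i)).symm
  -- the even permutation realising the flip
  set ρ : Equiv.Perm (Fin t) := Equiv.swap (p i) (nx (p i)) * Equiv.swap q0 q1 with hρ
  have hsign : Equiv.Perm.sign ρ = 1 := by
    rw [hρ, Equiv.Perm.sign_mul, Equiv.Perm.sign_swap hab, Equiv.Perm.sign_swap hq01]
    decide
  have hfix : ∀ c ∈ X, ρ c = c := fun c hc => by
    rw [hρ, Equiv.Perm.mul_apply, Equiv.swap_apply_of_ne_of_ne (fun h : c = q0 => hq0X (h ▸ hc))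
      (fun h : c = q1 => hq1X (h ▸ hc)), Equiv.swap_apply_of_ne_of_ne
      (fun h : c = p i => hpX (h ▸ hc)) (fun h : c = nx (p i) => hnX (h ▸ hc))]
  -- the flip is the action of `ρ` on block `i`
  have key : (fun j q => xOf y j (((Pi.mulSingle i ρ : Fin m → Equiv.Perm (Fin t)) j).symm q)) =
      xOf (Function.update y i (y i + 1)) := by
    funext j q
    by_cases hj : j = i
    · subst hj
      rw [Pi.mulSingle_eq_same, hxOf, hxOf, Function.update_self]
      have hρq : ρ.symm q = Equiv.swap q0 q1 (Equiv.swap (p j) (nx (p j)) q) := rfl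
      rw [hρq]
      rcases eq_or_ne q (p j) with rfl | hqa
      · rw [Equiv.swap_apply_left, Equiv.swap_apply_of_ne_of_ne hq0b.symm hq1b.symm,
          if_neg hab.symm, if_pos rfl, if_pos rfl]
      rcases eq_or_ne q (nx (p j)) with rfl | hqb
      · rw [Equiv.swap_apply_right, Equiv.swap_apply_of_ne_of_ne hq0a.symm hq1a.symm,
          if_pos rfl, if_neg hqa, if_pos rfl, h2]
      rw [Equiv.swap_apply_of_ne_of_ne hqa hqb, if_neg hqa, if_neg hqb]
      rcases eq_or_ne q q0 with rfl | hq0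
      · rw [Equiv.swap_apply_left, if_neg hq1a, if_neg hq1b]
      rcases eq_or_ne q q1 with rfl | hq1
      · rw [Equiv.swap_apply_right, if_neg hq0a, if_neg hq0b]
      rw [Equiv.swap_apply_of_ne_of_ne hq0 hq1, if_neg hqa, if_neg hqb]
    · rw [Pi.mulSingle_eq_of_ne hj, hxOf, hxOf, Function.update_of_ne hj]
      rfl
  have := hX ρ hfix hsign (xOf y)
  rw [key] at this
  exact this

/-- **Junta from single flips.** If `f` is unchanged by flipping any coordinate outside `B`, then `f`
depends only on the coordinates in `B`. -/
theorem junta_of_flip {m : ℕ} (f : (Fin m → ZMod 2) → ℝ) (B : Finset (Fin m))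
    (hflip : ∀ y i, i ∉ B → f (Function.update y i (y i + 1)) = f y)
    (y y' : Fin m → ZMod 2) (hyy' : ∀ i ∈ B, y i = y' i) : f y = f y' := by
  classical
  have hstep : ∀ a b : ZMod 2, a ≠ b → a + 1 = b := by decide
  suffices H : ∀ (n : ℕ) (y : Fin m → ZMod 2), (univ.filter fun i => y i ≠ y' i).card = n →
      (∀ i ∈ B, y i = y' i) → f y = f y' from H _ y rfl hyy'
  intro n
  induction n with
  | zero =>
    intro y h0 _
    rw [card_eq_zero, filter_eq_empty_iff] at h0
    rw [show y = y' from funext fun i => not_not.1 (h0 (mem_univ i))]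
  | succ n ih =>
    intro y hcard hB
    obtain ⟨i, hi⟩ : (univ.filter fun i => y i ≠ y' i).Nonempty := card_pos.1 (by omega)
    have hne : y i ≠ y' i := (mem_filter.1 hi).2
    have hiB : i ∉ B := fun h => hne (hB i h)
    set y₁ := Function.update y i (y i + 1) with hy₁
    have hy₁i : y₁ i = y' i := by rw [hy₁, Function.update_self]; exact hstep _ _ hne
    have hcard₁ : (univ.filter fun j => y₁ j ≠ y' j).card = n := by
      have hset : (univ.filter fun j => y₁ j ≠ y' j) =
          (univ.filter fun j => y j ≠ y' j).erase i := by
        ext j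
        by_cases hj : j = i
        · subst hj; simp [hy₁i]
        · simp [hy₁, hj]
      rw [hset, card_erase_of_mem hi, hcard]
      rfl
    have hB₁ : ∀ j ∈ B, y₁ j = y' j := fun j hj => by
      have hji : j ≠ i := fun h => hiB (h ▸ hj)
      rw [hy₁, Function.update_of_ne hji]
      exact hB j hj
    rw [← hflip y i hiB]
    exact ih y₁ hcard₁ hB₁

/-! ## §5 The theorem -/

/-- **Equivariant ε-exact LP lifting** (binder form of the registered sub-goal
`exactLifting_equivariant_lp` of stmt-PneNP-10680).  If `F` carries a degree-`d` perfect-completeness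
pseudo-expectation then, for `t ≥ T(m, d)` and every `ε > 0`, every non-negative factorisation
`viol_F(x[w]) - ε = ∑_l U x l * V l w` that is symmetric under the gadget group `(S_t)^m` (each block
permutation `σ` is compensated by a relabelling `τ` of the terms) has at least `C(t, d)` terms.
(Unsatisfiability of `F` is not needed: only `Ẽ[viol_F] = 0`, `Ẽ[1] = 1` are used.) -/
theorem exactLifting_equivariant_lp_of {m d : ℕ} {F : Finset (Pool m)}
    (hE : HasPerfectPseudoExp d F) :
    ∃ T : ℕ, ∀ (t : ℕ) (ε : ℝ), T ≤ t → 0 < ε → ∀ (L : Type) [Fintype L]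
      (U : (Fin m → Fin t → ZMod 2) → L → ℝ) (V : L → (Fin m → Fin t) → ℝ),
      (∀ x l, 0 ≤ U x l) → (∀ l w, 0 ≤ V l w) →
      (∀ x w, (viol F (fun i => x i (w i)) : ℝ) - ε = ∑ l, U x l * V l w) →
      (∀ σ : Fin m → Equiv.Perm (Fin t), ∃ τ : L ≃ L, ∀ l,
          (∀ x, U (fun i p => x i ((σ i).symm p)) (τ l) = U x l) ∧
          (∀ w, V (τ l) (fun i => σ i (w i)) = V l w)) →
      t.choose d ≤ Fintype.card L := by
  classical
  refine ⟨max 9 (max (4 * d + 8) (m.choose (d + 1) * (2 * d) ^ (d + 1))), ?_⟩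
  intro t ε hT hε L _ U V hU hV hid hsym
  simp only [max_le_iff] at hT
  obtain ⟨ht9, h4d, hK⟩ := hT
  by_contra hlt
  push Not at hlt
  obtain ⟨E, hSA, -, hone, hviol⟩ := hE
  -- (1)+(2): relabellings and per-block supports
  choose τ hτ using hsym
  have hsupp : ∀ (l : L) (i : Fin m), ∃ X : Finset (Fin t), X.card < d ∧
      ∀ ρ : Equiv.Perm (Fin t), (∀ a ∈ X, ρ a = a) → Equiv.Perm.sign ρ = 1 →
        ∀ x, U (fun j q => x j (((Pi.mulSingle i ρ : Fin m → Equiv.Perm (Fin t)) j).symm q)) l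
          = U x l := by
    intro l i
    have hd : 1 ≤ d := Nat.pos_of_ne_zero fun h0 => by
      subst h0
      have := Fintype.card_pos_iff.2 ⟨l⟩
      rw [Nat.choose_zero_right] at hlt
      omega
    exact exists_blockSupport U (fun σ l => τ σ l) (fun σ l x => (hτ σ l).1 x) (by omega) hd
      (by omega) hlt l i
  choose X hXcard hXinv using hsupp
  -- (3): the pointer
  have hnx : ∀ a : Fin t, finRotate t a ≠ a := fun a =>
    Equiv.Perm.mem_support.1 (by rw [support_finRotate_of_le (by omega)]; exact mem_univ a)
  have hLt : Fintype.card L * (m.choose (d + 1) * (2 * d) ^ (d + 1)) < t ^ (d + 1) := by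
    rcases Nat.eq_zero_or_pos (m.choose (d + 1) * (2 * d) ^ (d + 1)) with h0 | h0
    · rw [h0, mul_zero]
      exact pow_pos (by omega) _
    · calc _ < t.choose d * (m.choose (d + 1) * (2 * d) ^ (d + 1)) :=
            Nat.mul_lt_mul_of_pos_right hlt h0
        _ ≤ t ^ d * t := Nat.mul_le_mul (Nat.choose_le_pow t d) hK
        _ = t ^ (d + 1) := (pow_succ t d).symm
  obtain ⟨p, hp⟩ := exists_pointer X hXcard (finRotate t) (by omega) hLt
  -- (4): the tables `x^y`
  set xOf : (Fin m → ZMod 2) → Fin m → Fin t → ZMod 2 := fun y j q =>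
    if q = p j then y j else if q = finRotate t (p j) then y j + 1 else 0
  have hxOf : ∀ y j q, xOf y j q =
      if q = p j then y j else if q = finRotate t (p j) then y j + 1 else 0 := fun _ _ _ => rfl
  have hread : ∀ y, (fun i => xOf y i (p i)) = y := fun y => funext fun i => by
    rw [hxOf, if_pos rfl]
  -- the junta terms
  set h : L → (Fin m → ZMod 2) → ℝ := fun l y => U (xOf y) l * V l p
  have hjunta : ∀ l, IsJunta d (h l) := by
    intro l
    refine ⟨univ.filter fun i => p i ∈ X l i ∨ finRotate t (p i) ∈ X l i, hp l,
      fun y y' hyy' => ?_⟩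
    have hflip : ∀ (y : Fin m → ZMod 2) (i : Fin m),
        i ∉ (univ.filter fun i => p i ∈ X l i ∨ finRotate t (p i) ∈ X l i) →
        U (xOf (Function.update y i (y i + 1))) l = U (xOf y) l := by
      intro y i hi
      simp only [mem_filter, mem_univ, true_and, not_or] at hi
      exact flip_invariant U l i (X l i) (hXinv l i) p (finRotate t) hnx hi.1 hi.2
        (by have := hXcard l i; omega) xOf hxOf y
    show U (xOf y) l * V l p = U (xOf y') l * V l p
    rw [junta_of_flip (fun y => U (xOf y) l) _ hflip y y' hyy']
  have hpos : ∀ l, 0 ≤ E (h l) := fun l =>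
    hSA (h l) (hjunta l) fun y => mul_nonneg (hU _ _) (hV _ _)
  -- (5): the pseudo-expectation endgame
  have hfun : (fun y => (viol F y : ℝ)) - ε • (fun _ => (1 : ℝ)) = ∑ l, h l := by
    funext y
    have := hid (xOf y) p
    rw [hread y] at this
    simp only [Pi.sub_apply, Pi.smul_apply, smul_eq_mul, mul_one, Finset.sum_apply]
    exact this
  have hlhs : E ((fun y => (viol F y : ℝ)) - ε • (fun _ => (1 : ℝ))) = -ε := by
    rw [map_sub, map_smul, hviol, hone, smul_eq_mul, mul_one, zero_sub]
  have hrhs : 0 ≤ E (∑ l, h l) := by rw [map_sum]; exact Finset.sum_nonneg fun l _ => hpos l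
  rw [← hfun, hlhs] at hrhs
  linarith

/-- **Equivariant ε-exact LP lifting** — registered sub-goal `exactLifting_equivariant_lp` of
stmt-PneNP-10680 (milestone of the open stub `stub_exactLifting`), verbatim signature: gadget-symmetric
non-negative factorisations of a positive shift of the Index-lift of `viol_F` need `C(t, d)` terms
(see `exactLifting_equivariant_lp_of`). -/
theorem exactLifting_equivariant_lp : ∀ (m d : ℕ) (F : Finset (Pool m)), (¬ ∃ y : Fin m → ZMod 2,
    ∀ e ∈ F, Sat y e) → HasPerfectPseudoExp d F → ∃ T : ℕ, ∀ (t : ℕ) (ε : ℝ), T ≤ t → 0 < ε → ∀ (L :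
    Type) [Fintype L] (U : (Fin m → Fin t → ZMod 2) → L → ℝ) (V : L → (Fin m → Fin t) → ℝ), (∀ x l, 0
    ≤ U x l) → (∀ l w, 0 ≤ V l w) → (∀ x w, (viol F (fun i => x i (w i)) : ℝ) - ε = ∑ l, U x l * V l
    w) → (∀ σ : Fin m → Equiv.Perm (Fin t), ∃ τ : L ≃ L, ∀ l, (∀ x, U (fun i p => x i ((σ i).symm p))
    (τ l) = U x l) ∧ (∀ w, V (τ l) (fun i => σ i (w i)) = V l w)) → t.choose d ≤ Fintype.card L :=
  fun _ _ _ _ hE => exactLifting_equivariant_lp_of hE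

end Summit.PneNP.PneNP.Theorems.XorDoor
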